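import Mathlib.Order.SupClosed
import Mathlib.Order.Hom.Lattice
import Mathlib.Data.Set.Lattice
import Mathlib.Data.Fintype.Basic
import Mathlib.Data.Finset.Lattice.Fold
import Mathlib.Order.Interval.Set.Defs
import HarnessLib

/-!
# The structure of sublattices of a product of lattices (Topkis 1976)

D. M. Topkis, *The structure of sublattices of the product of `n` lattices*, Pacific J. Math.
**65** (1976) 525–532 [Topkis1976], §1 in full:

* **Theorem 1** (p. 526). If `S₁, …, Sₙ` are lattices, `n > 1`, `S = ×ᵢ Sᵢ`, then a set `L ⊆ S` is a
  sublattice iff it is the intersection of `n(n-1)/2` *bivariate* sublattices of `S`; in the proof,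
  `L = ⋂_{j ≠ k} L_{jk}` with `L_{jk} = {x ∈ S : (x_j, x_k) ∈ T_{jk}}` the cylinder over the
  two-dimensional projection `T_{jk} = π_{jk} L` (eqs. (1), (2), and `L_{jk} = L_{kj}`).  The factors
  are ARBITRARY lattices (Topkis), not only chains.  Lean: `IsSublattice.eq_iInter_cylinder_proj₂`
  (ordered pairs `j ≠ k`), `IsSublattice.eq_iInter_cylinder_proj₂_of_lt` (the `n(n-1)/2` pairs `j < k`
  of a linearly ordered index type), the membership form `IsSublattice.mem_iff_forall_proj₂`
  (`x ∈ L ↔ ∀ j k, (x_j, x_k) ∈ π_{jk} L`), and the iff `isSublattice_iff_exists_bivariate`.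
* p. 526: for distinct `j, k` the bivariate set with `jk`-generator `T` is a sublattice iff `T` is
  (`isSublattice_cylinder_iff`).
* **Lemma 1** (p. 528): the two *bimonotone hulls* `H₁(L) = ⋃_{x ∈ L} [x₁, ∞) × (-∞, x₂]`,
  `H₂(L) = ⋃_{x ∈ L} (-∞, x₁] × [x₂, ∞)` of a sublattice of `S₁ × S₂` are sublattices
  (`isSublattice_bimonotoneHull₁/₂`); p. 527: a bimonotone subset of a product of two CHAINS is a
  sublattice (`IsBimonotone.isSublattice`), the hulls are the smallest bimonotone supersets
  (`bimonotoneHull₁_min`, …).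
* **Lemma 2** (p. 528): `L` a sublattice of `S₁ × S₂`, `a₂, b₂` in the section `L₁(x₁)` ⟹
  `Π₂ L ∩ [a₂, b₂] ⊆ L₁(x₁)` (`IsSublattice.snd_image_inter_Icc_subset_section`, and the mirror
  statement for sections at `x₂`); **Corollary 1**: a section containing its infimum and supremum is
  `Π₂ L ∩ [a₂, b₂]` (`IsSublattice.section_eq_of_isLeast_isGreatest`).
* **Theorem 2** (p. 528): a sublattice of `S₁ × S₂` is the intersection of its two bimonotone hulls and
  the product of its two projections (`IsSublattice.eq_bimonotoneHull_inter_prod`).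
* **Corollary 2** / **Theorem 3** (p. 529): a (bivariate) sublattice of `×ᵢ Sᵢ` is the intersection of
  (`2`, resp. `n(n-1)`) bimonotone sublattices and `×ᵢ Πᵢ L`
  (`IsSublattice.eq_bimonotone_inter_pi_of_isBivariate`, `IsSublattice.eq_iInter_bimonotone_inter_pi`,
  iff forms `isSublattice_iff_exists_bimonotone(_of_linearOrder)`).

Also M. Queyranne, F. Tardella, *Sublattices of product spaces: hulls, representations and counting*,
Discrete Math. **308** (2008) 1508–1523 [QueyranneTardella2008]: **Proposition 1** (projections and
sublattice hulls commute, `proj₂_latticeClosure`, via Mathlib's `image_latticeClosure`) and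
**Theorem 3 (i)** (for a finite index set the sublattice hull `latticeClosure Q` is the intersection of
the cylinders over the hulls of the two-dimensional projections of `Q`, `latticeClosure_eq_iInter_cylinder`).

## Design / scope notes

* The product is Mathlib's dependent `Π i, α i` over an index type `ι`; Topkis's `n > 1` is
  `[Nontrivial ι]`, finiteness `[Finite ι]` (Queyranne–Tardella, Example 2: the representation fails for
  infinite `ι`).  Sections and projections of `L ⊆ S₁ × S₂` are written with Mathlib primitives:
  `L₁(x₁) = Prod.mk x₁ ⁻¹' L`, `L₂(x₂) = (·, x₂) ⁻¹' L`, `Π₁ L = Prod.fst '' L`, `Π₂ L = Prod.snd '' L`,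
  `Πᵢ L = Function.eval i '' L`.  The `IsSublattice.*` theorems live in THIS namespace
  (`Literature.Order.Sublattices.IsSublattice.*`, Mathlib's `IsSublattice` is not extended): apply them
  explicitly, `IsSublattice.eq_iInter_cylinder_proj₂ hL`.
* Theorem 3, "if" direction: as printed ("`L` is a sublattice iff it is the intersection of `n(n-1)`
  bimonotone sublattices of `S` and `×ᵢ Πᵢ L`") the converse tacitly uses that `×ᵢ Πᵢ L` is a
  sublattice, which is automatic when the `Sᵢ` are chains (the setting of Topkis's applications,
  `isSublattice_iff_exists_bimonotone_of_linearOrder`) but not for general lattices (`S₁` the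
  four-element Boolean lattice, `S₂` a point, `L = {a, aᶜ} × S₂` is `S ∩ S ∩ (Π₁ L × Π₂ L)` and not a
  sublattice); the general iff `isSublattice_iff_exists_bimonotone` therefore carries the hypothesis
  `∀ i, IsSublattice (Πᵢ L)` explicitly.  Nothing else is weakened or strengthened.
* NOT here: §2 of [Topkis1976] (sublattice-generating functions, Lemma 3) and §§3–6 of
  [QueyranneTardella2008] (boundary epigraphs, counting, encoding, membership algorithms).
-/

namespace Literature.Order.Sublattices

open Set

universe u v

variable {ι : Type u} {α : ι → Type v}

/-! ### Two-dimensional projections, cylinders, bivariate sets -/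

section General

variable (j k : ι)

/-- The two-dimensional projection `π_{jk} L = {(x_j, x_k) : x ∈ L} ⊆ S_j × S_k` of `L ⊆ ×ᵢ Sᵢ`
(Topkis's `T_{jk}` in the proof of Theorem 1; Queyranne–Tardella's `π_{ij}`).
[cite: Topkis1976, §1 p. 526 (proof of Thm 1)] -/
def proj₂ (L : Set (∀ i, α i)) : Set (α j × α k) := (fun x => (x j, x k)) '' L

/-- The *bivariate subset* of `S = ×ᵢ Sᵢ` with `jk`-generator `T ⊆ S_j × S_k`:
`{x ∈ S : (x_j, x_k) ∈ T}` (Queyranne–Tardella: the cylinder `Cyl T`).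
[cite: Topkis1976, §1 p. 526] -/
def cylinder (T : Set (α j × α k)) : Set (∀ i, α i) := (fun x => (x j, x k)) ⁻¹' T

/-- `L ⊆ ×ᵢ Sᵢ` is a *bivariate subset* (in the coordinates `j, k`): it is the cylinder over some
`T ⊆ S_j × S_k`, its `jk`-generator. [cite: Topkis1976, §1 p. 526] -/
def IsBivariate (L : Set (∀ i, α i)) : Prop := ∃ T : Set (α j × α k), L = cylinder j k T

variable {j k}

/-- Membership in the two-dimensional projection. [cite: Topkis1976, §1 p. 526 (proof of Thm 1)] -/
@[simp] theorem mem_proj₂ {L : Set (∀ i, α i)} {p : α j × α k} :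
    p ∈ proj₂ j k L ↔ ∃ x ∈ L, x j = p.1 ∧ x k = p.2 := by
  simp only [proj₂, mem_image, Prod.ext_iff]

/-- Membership in a cylinder. [cite: Topkis1976, §1 p. 526] -/
@[simp] theorem mem_cylinder {T : Set (α j × α k)} {x : ∀ i, α i} :
    x ∈ cylinder j k T ↔ (x j, x k) ∈ T := Iff.rfl

/-- `x ∈ L ⟹ (x_j, x_k) ∈ π_{jk} L`. [cite: Topkis1976, §1 p. 526 (proof of Thm 1)] -/
theorem mk_mem_proj₂ {L : Set (∀ i, α i)} {x : ∀ i, α i} (hx : x ∈ L) :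
    (x j, x k) ∈ proj₂ j k L :=
  mem_proj₂.2 ⟨x, hx, rfl, rfl⟩

/-- `L ⊆ L_{jk}` (one pair of Topkis's eq. (1)). [cite: Topkis1976, Thm 1 eq. (1)] -/
theorem subset_cylinder_proj₂ (L : Set (∀ i, α i)) : L ⊆ cylinder j k (proj₂ j k L) :=
  fun _ hx => mk_mem_proj₂ hx

/-- Cylinders are monotone in the generator. [cite: Topkis1976, §1 p. 526] -/
theorem cylinder_mono {T T' : Set (α j × α k)} (h : T ⊆ T') : cylinder j k T ⊆ cylinder j k T' :=
  fun _ hx => h hx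

/-- A cylinder is a bivariate set. [cite: Topkis1976, §1 p. 526] -/
theorem isBivariate_cylinder (T : Set (α j × α k)) : IsBivariate j k (cylinder j k T) := ⟨T, rfl⟩

/-- `L_{jk} = L_{kj}`. [cite: Topkis1976, Thm 1 (proof: last line)] -/
theorem cylinder_proj₂_comm (L : Set (∀ i, α i)) :
    cylinder j k (proj₂ j k L) = cylinder k j (proj₂ k j L) := by
  ext x
  rw [mem_cylinder, mem_cylinder, mem_proj₂, mem_proj₂]
  exact ⟨fun ⟨y, hy, h1, h2⟩ => ⟨y, hy, h2, h1⟩, fun ⟨y, hy, h1, h2⟩ => ⟨y, hy, h2, h1⟩⟩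

/-- A bivariate set is the cylinder over its own two-dimensional projection.
[cite: Topkis1976, §1 p. 526] -/
theorem IsBivariate.eq_cylinder_proj₂ {L : Set (∀ i, α i)} (h : IsBivariate j k L) :
    L = cylinder j k (proj₂ j k L) := by
  refine (subset_cylinder_proj₂ L).antisymm fun x hx => ?_
  obtain ⟨T, rfl⟩ := h
  simp only [mem_cylinder, mem_proj₂] at hx
  obtain ⟨y, hy, h1, h2⟩ := hx
  rw [mem_cylinder]
  rwa [← h1, ← h2]

/-- For distinct `j, k` (and nonempty factors) the generator of a bivariate set is recovered as its
two-dimensional projection: `π_{jk} {x : (x_j, x_k) ∈ T} = T`. [cite: Topkis1976, §1 p. 526] -/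
theorem proj₂_cylinder [DecidableEq ι] [∀ i, Nonempty (α i)] (hjk : j ≠ k)
    (T : Set (α j × α k)) : proj₂ j k (cylinder j k T) = T := by
  ext p
  simp only [mem_proj₂, mem_cylinder]
  constructor
  · rintro ⟨x, hx, h1, h2⟩
    rwa [h1, h2] at hx
  · intro hp
    let x₀ : ∀ i, α i := fun i => Classical.arbitrary (α i)
    refine ⟨Function.update (Function.update x₀ j p.1) k p.2, ?_, ?_, ?_⟩
    · simpa [Function.update_of_ne hjk] using hp
    · simp [Function.update_of_ne hjk]
    · simp

/-- Topkis's eq. (1): `L ⊆ ⋂_{j ≠ k} L_{jk}` (no hypothesis on `L`). [cite: Topkis1976, Thm 1 eq. (1)] -/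
theorem subset_iInter_cylinder_proj₂ (L : Set (∀ i, α i)) :
    L ⊆ ⋂ j, ⋂ k, ⋂ (_ : j ≠ k), cylinder j k (proj₂ j k L) := by
  simp only [subset_iInter_iff]
  exact fun j k _ => subset_cylinder_proj₂ L

end General

/-! ### Theorem 1: sublattices of a finite product of lattices -/

section Lattice

variable [∀ i, Lattice (α i)] {j k : ι}

/-- The map `x ↦ (x_j, x_k)` is a lattice homomorphism `×ᵢ Sᵢ → S_j × S_k` (componentwise
operations). [cite: Topkis1976, §1 p. 526] -/
def pairLatticeHom (j k : ι) : LatticeHom (∀ i, α i) (α j × α k) where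
  toFun x := (x j, x k)
  map_sup' _ _ := rfl
  map_inf' _ _ := rfl

/-- [cite: Topkis1976, §1 p. 526] -/
@[simp] theorem pairLatticeHom_apply (j k : ι) (x : ∀ i, α i) :
    pairLatticeHom j k x = (x j, x k) := rfl

/-- "`T_{jk}` is a sublattice of `S_j × S_k` because `L` is a sublattice of `S`".
[cite: Topkis1976, Thm 1 (proof)] -/
theorem isSublattice_proj₂ {L : Set (∀ i, α i)} (hL : IsSublattice L) :
    IsSublattice (proj₂ j k L) :=
  hL.image (pairLatticeHom j k)

/-- A cylinder over a sublattice of `S_j × S_k` is a sublattice of `S` ("hence `L_{jk}` is a bivariate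
sublattice of `S`"). [cite: Topkis1976, §1 p. 526] -/
theorem isSublattice_cylinder {T : Set (α j × α k)} (hT : IsSublattice T) :
    IsSublattice (cylinder j k T) :=
  hT.preimage (pairLatticeHom j k)

/-- p. 526: "If `S₁, …, Sₙ` are lattices and `T` is the `jk`-generator of a bivariate subset `L` of
`S = ×ᵢ Sᵢ` [`j, k` two distinct indices] then `L` is a sublattice of `S` if and only if `T` is a
sublattice of `S_j × S_k`." [cite: Topkis1976, §1 p. 526] -/
theorem isSublattice_cylinder_iff [DecidableEq ι] [∀ i, Nonempty (α i)] (hjk : j ≠ k)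
    {T : Set (α j × α k)} : IsSublattice (cylinder j k T) ↔ IsSublattice T := by
  refine ⟨fun h => ?_, isSublattice_cylinder⟩
  have h' : IsSublattice (proj₂ j k (cylinder j k T)) := isSublattice_proj₂ h
  rwa [proj₂_cylinder hjk] at h'

variable {L : Set (∀ i, α i)}

/-- The heart of Theorem 1 (Topkis's eq. (2)), in the unrestricted-pair form: if `L` is a sublattice of
a finite nonempty product of lattices and for all `j, k` some `y ∈ L` has `y_j = x_j`, `y_k = x_k`,
then `x ∈ L` — namely `x = ⋁ⱼ ⋀ₖ y^{jk}`. [cite: Topkis1976, Thm 1 eq. (2) (proof)] -/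
theorem IsSublattice.mem_of_forall_proj₂ [Finite ι] [Nonempty ι] (hL : IsSublattice L)
    {x : ∀ i, α i} (h : ∀ j k, ∃ y ∈ L, y j = x j ∧ y k = x k) : x ∈ L := by
  classical
  cases nonempty_fintype ι
  choose y hyL hyj hyk using h
  have hne : (Finset.univ : Finset ι).Nonempty := Finset.univ_nonempty
  -- `u j = ⋀ₖ y^{jk}`: in `L`, `j`-th coordinate `x_j`, below `x`.
  set u : ι → ∀ i, α i := fun j => Finset.univ.inf' hne (y j) with hu
  have huL : ∀ j, u j ∈ L := fun j => hL.infClosed.finsetInf'_mem hne fun k _ => hyL j k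
  have hujj : ∀ j, u j j = x j := by
    intro j
    simp only [hu, Finset.inf'_apply, hyj, Finset.inf'_const]
  have hule : ∀ j i, u j i ≤ x i := by
    intro j i
    simp only [hu, Finset.inf'_apply]
    exact (Finset.inf'_le (fun k => y j k i) (Finset.mem_univ i)).trans_eq (hyk j i)
  -- `x = ⋁ⱼ u j ∈ L`.
  have hz : Finset.univ.sup' hne u = x := by
    funext i
    rw [Finset.sup'_apply]
    refine le_antisymm (Finset.sup'_le _ _ fun j _ => hule j i) ?_
    calc x i = u i i := (hujj i).symm
      _ ≤ Finset.univ.sup' hne fun j => u j i := Finset.le_sup' (fun j => u j i) (Finset.mem_univ i)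
  rw [← hz]
  exact hL.supClosed.finsetSup'_mem hne fun j _ => huL j

/-- Membership form of Theorem 1: for a sublattice `L` of a finite nonempty product of lattices,
`x ∈ L ↔ ∀ j k, (x_j, x_k) ∈ π_{jk} L` (Queyranne–Tardella (2): `L` "is determined by its
two-dimensional projections"). [cite: Topkis1976, Thm 1] [cite: QueyranneTardella2008, Thm 3 (2)] -/
theorem IsSublattice.mem_iff_forall_proj₂ [Finite ι] [Nonempty ι] (hL : IsSublattice L)
    {x : ∀ i, α i} : x ∈ L ↔ ∀ j k, (x j, x k) ∈ proj₂ j k L := by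
  refine ⟨fun hx j k => mk_mem_proj₂ hx, fun h => IsSublattice.mem_of_forall_proj₂ hL fun j k => ?_⟩
  simpa using h j k

/-- Topkis's eq. (2) as printed (distinct pairs, `n > 1`): if `(x_j, x_k) ∈ T_{jk}` for all `j ≠ k`
then `x ∈ L`. [cite: Topkis1976, Thm 1 eq. (2)] -/
theorem IsSublattice.mem_of_forall_ne_proj₂ [Finite ι] [Nontrivial ι] (hL : IsSublattice L)
    {x : ∀ i, α i} (h : ∀ j k, j ≠ k → (x j, x k) ∈ proj₂ j k L) : x ∈ L := by
  refine IsSublattice.mem_of_forall_proj₂ hL fun j k => ?_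
  by_cases hjk : j = k
  · subst hjk
    obtain ⟨k', hk'⟩ := exists_ne j
    obtain ⟨y, hy, hyj, -⟩ := mem_proj₂.1 (h j k' hk'.symm)
    exact ⟨y, hy, hyj, hyj⟩
  · obtain ⟨y, hy, h1, h2⟩ := mem_proj₂.1 (h j k hjk)
    exact ⟨y, hy, h1, h2⟩

/-- **Theorem 1** [Topkis1976], the representation: a sublattice `L` of a finite product of `n > 1`
lattices satisfies `L = ⋂_{j ≠ k} L_{jk}`, `L_{jk} = {x : (x_j, x_k) ∈ π_{jk} L}`.
[cite: Topkis1976, Thm 1] -/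
theorem IsSublattice.eq_iInter_cylinder_proj₂ [Finite ι] [Nontrivial ι] (hL : IsSublattice L) :
    L = ⋂ j, ⋂ k, ⋂ (_ : j ≠ k), cylinder j k (proj₂ j k L) := by
  refine (subset_iInter_cylinder_proj₂ L).antisymm fun x hx => ?_
  refine IsSublattice.mem_of_forall_ne_proj₂ hL fun j k hjk => ?_
  simp only [mem_iInter, mem_cylinder] at hx
  exact hx j k hjk

/-- **Theorem 1** [Topkis1976] with exactly `n(n-1)/2` bivariate sublattices (`L_{jk} = L_{kj}`):
for a linearly ordered finite index type, `L = ⋂_{j < k} L_{jk}`. [cite: Topkis1976, Thm 1] -/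
theorem IsSublattice.eq_iInter_cylinder_proj₂_of_lt [LinearOrder ι] [Finite ι] [Nontrivial ι]
    (hL : IsSublattice L) : L = ⋂ j, ⋂ k, ⋂ (_ : j < k), cylinder j k (proj₂ j k L) := by
  refine subset_antisymm ?_ fun x hx => IsSublattice.mem_of_forall_ne_proj₂ hL fun j k hjk => ?_
  · simp only [subset_iInter_iff]
    exact fun j k _ => subset_cylinder_proj₂ L
  · simp only [mem_iInter] at hx
    rcases lt_or_gt_of_ne hjk with hlt | hlt
    · exact hx j k hlt
    · have hx' : x ∈ cylinder k j (proj₂ k j L) := hx k j hlt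
      rw [← cylinder_proj₂_comm] at hx'
      exact hx'

/-- **Theorem 1** [Topkis1976] (iff form): "If `S₁, …, Sₙ` are lattices, `n > 1`, and `S = ×ᵢ Sᵢ`,
then a set `L` is a sublattice of `S` if and only if it is the intersection of `n(n-1)/2` bivariate
sublattices of `S`" — here indexed by ordered pairs `j ≠ k` (the two cylinders of a pair may be taken
equal, `cylinder_proj₂_comm`). [cite: Topkis1976, Thm 1] -/
theorem isSublattice_iff_exists_bivariate [Finite ι] [Nontrivial ι] {L : Set (∀ i, α i)} :
    IsSublattice L ↔ ∃ T : ∀ j k : ι, Set (α j × α k),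
      (∀ j k, j ≠ k → IsSublattice (T j k)) ∧ L = ⋂ j, ⋂ k, ⋂ (_ : j ≠ k), cylinder j k (T j k) := by
  constructor
  · intro hL
    exact ⟨fun j k => proj₂ j k L, fun j k _ => isSublattice_proj₂ hL,
      IsSublattice.eq_iInter_cylinder_proj₂ hL⟩
  · rintro ⟨T, hT, rfl⟩
    exact isSublattice_iInter fun j => isSublattice_iInter fun k =>
      isSublattice_iInter fun hjk => isSublattice_cylinder (hT j k hjk)

/-- **Proposition 1** [QueyranneTardella2008] (projections and sublattice hulls commute), for the
two-dimensional projections: `π_{jk} (LQ) = L(π_{jk} Q)` with `L` = Mathlib's `latticeClosure`.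
[cite: QueyranneTardella2008, Prop 1] -/
theorem proj₂_latticeClosure (Q : Set (∀ i, α i)) :
    proj₂ j k (latticeClosure Q) = latticeClosure (proj₂ j k Q) :=
  image_latticeClosure Q (fun x => (x j, x k)) (fun _ _ => rfl) (fun _ _ => rfl)

/-- **Theorem 3 (i)** [QueyranneTardella2008] (sublattice hull representation by projections, finite
index set, `|I| > 1`): the sublattice hull of `Q ⊆ ×ᵢ Tᵢ` is the intersection of the cylinders over
the sublattice hulls of its two-dimensional projections, `LQ = ⋂_{i ≠ j} Cyl L(π_{ij} Q)`.
[cite: QueyranneTardella2008, Thm 3 (i) eq. (2)] -/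
theorem latticeClosure_eq_iInter_cylinder [Finite ι] [Nontrivial ι] (Q : Set (∀ i, α i)) :
    latticeClosure Q = ⋂ j, ⋂ k, ⋂ (_ : j ≠ k), cylinder j k (latticeClosure (proj₂ j k Q)) := by
  have h := IsSublattice.eq_iInter_cylinder_proj₂ (isSublattice_latticeClosure (s := Q))
  simp only [proj₂_latticeClosure] at h
  exact h

end Lattice

/-! ### Two factors: bimonotone sets and hulls, sections (Lemma 1, Lemma 2, Corollary 1, Theorem 2) -/

section TwoFactors

variable {S₁ : Type u} {S₂ : Type v}

section Preorder

variable [Preorder S₁] [Preorder S₂]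

/-- `L ⊆ S₁ × S₂` is bimonotone of the first kind: `[x₁, ∞) × (-∞, x₂] ⊆ L` for all `x ∈ L`.
[cite: Topkis1976, §1 p. 527] -/
def IsBimonotone₁ (L : Set (S₁ × S₂)) : Prop :=
  ∀ ⦃x⦄, x ∈ L → ∀ ⦃y : S₁ × S₂⦄, x.1 ≤ y.1 → y.2 ≤ x.2 → y ∈ L

/-- `L ⊆ S₁ × S₂` is bimonotone of the second kind: `(-∞, x₁] × [x₂, ∞) ⊆ L` for all `x ∈ L`.
[cite: Topkis1976, §1 p. 527] -/
def IsBimonotone₂ (L : Set (S₁ × S₂)) : Prop :=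
  ∀ ⦃x⦄, x ∈ L → ∀ ⦃y : S₁ × S₂⦄, y.1 ≤ x.1 → x.2 ≤ y.2 → y ∈ L

/-- "If `S₁` and `S₂` are posets, `L ⊆ S₁ × S₂`, and either `[x₁, ∞) × (-∞, x₂] ⊆ L` for all
`(x₁, x₂) ∈ L` or `(-∞, x₁] × [x₂, ∞) ⊆ L` for all `(x₁, x₂) ∈ L`, then `L` is *bimonotone*."
[cite: Topkis1976, §1 p. 527] -/
def IsBimonotone (L : Set (S₁ × S₂)) : Prop := IsBimonotone₁ L ∨ IsBimonotone₂ L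

/-- The first bimonotone hull `H₁(L) = ⋃_{x ∈ L} [x₁, ∞) × (-∞, x₂]`. [cite: Topkis1976, §1 p. 527] -/
def bimonotoneHull₁ (L : Set (S₁ × S₂)) : Set (S₁ × S₂) := {y | ∃ x ∈ L, x.1 ≤ y.1 ∧ y.2 ≤ x.2}

/-- The second bimonotone hull `H₂(L) = ⋃_{x ∈ L} (-∞, x₁] × [x₂, ∞)`. [cite: Topkis1976, §1 p. 527] -/
def bimonotoneHull₂ (L : Set (S₁ × S₂)) : Set (S₁ × S₂) := {y | ∃ x ∈ L, y.1 ≤ x.1 ∧ x.2 ≤ y.2}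

variable {L M : Set (S₁ × S₂)}

/-- [cite: Topkis1976, §1 p. 527] -/
@[simp] theorem mem_bimonotoneHull₁ {y : S₁ × S₂} :
    y ∈ bimonotoneHull₁ L ↔ ∃ x ∈ L, x.1 ≤ y.1 ∧ y.2 ≤ x.2 := Iff.rfl

/-- [cite: Topkis1976, §1 p. 527] -/
@[simp] theorem mem_bimonotoneHull₂ {y : S₁ × S₂} :
    y ∈ bimonotoneHull₂ L ↔ ∃ x ∈ L, y.1 ≤ x.1 ∧ x.2 ≤ y.2 := Iff.rfl

/-- `H₁(L)` as the union of the sets `[x₁, ∞) × (-∞, x₂]`, `x ∈ L`. [cite: Topkis1976, §1 p. 527] -/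
theorem bimonotoneHull₁_eq_biUnion (L : Set (S₁ × S₂)) :
    bimonotoneHull₁ L = ⋃ x ∈ L, Ici x.1 ×ˢ Iic x.2 := by
  ext y
  simp only [mem_bimonotoneHull₁, mem_iUnion, mem_prod, mem_Ici, mem_Iic, exists_prop]

/-- `H₂(L)` as the union of the sets `(-∞, x₁] × [x₂, ∞)`, `x ∈ L`. [cite: Topkis1976, §1 p. 527] -/
theorem bimonotoneHull₂_eq_biUnion (L : Set (S₁ × S₂)) :
    bimonotoneHull₂ L = ⋃ x ∈ L, Iic x.1 ×ˢ Ici x.2 := by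
  ext y
  simp only [mem_bimonotoneHull₂, mem_iUnion, mem_prod, mem_Ici, mem_Iic, exists_prop]

/-- `L ⊆ H₁(L)`. [cite: Topkis1976, §1 p. 527] -/
theorem subset_bimonotoneHull₁ (L : Set (S₁ × S₂)) : L ⊆ bimonotoneHull₁ L :=
  fun x hx => ⟨x, hx, le_rfl, le_rfl⟩

/-- `L ⊆ H₂(L)`. [cite: Topkis1976, §1 p. 527] -/
theorem subset_bimonotoneHull₂ (L : Set (S₁ × S₂)) : L ⊆ bimonotoneHull₂ L :=
  fun x hx => ⟨x, hx, le_rfl, le_rfl⟩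

/-- `H₁(L)` is bimonotone (first kind). [cite: Topkis1976, §1 p. 527] -/
theorem isBimonotone₁_bimonotoneHull₁ (L : Set (S₁ × S₂)) : IsBimonotone₁ (bimonotoneHull₁ L) := by
  rintro y ⟨x, hx, h1, h2⟩ z hz1 hz2
  exact ⟨x, hx, h1.trans hz1, hz2.trans h2⟩

/-- `H₂(L)` is bimonotone (second kind). [cite: Topkis1976, §1 p. 527] -/
theorem isBimonotone₂_bimonotoneHull₂ (L : Set (S₁ × S₂)) : IsBimonotone₂ (bimonotoneHull₂ L) := by
  rintro y ⟨x, hx, h1, h2⟩ z hz1 hz2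
  exact ⟨x, hx, hz1.trans h1, h2.trans hz2⟩

/-- `H₁(L)` is the smallest bimonotone set of the first kind containing `L`.
[cite: Topkis1976, §1 p. 527] -/
theorem bimonotoneHull₁_min (hLM : L ⊆ M) (hM : IsBimonotone₁ M) : bimonotoneHull₁ L ⊆ M := by
  rintro y ⟨x, hx, h1, h2⟩
  exact hM (hLM hx) h1 h2

/-- `H₂(L)` is the smallest bimonotone set of the second kind containing `L`.
[cite: Topkis1976, §1 p. 527] -/
theorem bimonotoneHull₂_min (hLM : L ⊆ M) (hM : IsBimonotone₂ M) : bimonotoneHull₂ L ⊆ M := by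
  rintro y ⟨x, hx, h1, h2⟩
  exact hM (hLM hx) h1 h2

/-- A bimonotone set of the first kind is its own first hull. [cite: Topkis1976, §1 p. 527] -/
theorem IsBimonotone₁.bimonotoneHull₁_eq (h : IsBimonotone₁ L) : bimonotoneHull₁ L = L :=
  (bimonotoneHull₁_min Subset.rfl h).antisymm (subset_bimonotoneHull₁ L)

/-- A bimonotone set of the second kind is its own second hull. [cite: Topkis1976, §1 p. 527] -/
theorem IsBimonotone₂.bimonotoneHull₂_eq (h : IsBimonotone₂ L) : bimonotoneHull₂ L = L :=
  (bimonotoneHull₂_min Subset.rfl h).antisymm (subset_bimonotoneHull₂ L)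

end Preorder

section Chains

variable [LinearOrder S₁] [LinearOrder S₂] {L : Set (S₁ × S₂)}

/-- "If `S₁` and `S₂` are chains then a bimonotone subset of `S₁ × S₂` is clearly a sublattice"
(first kind). [cite: Topkis1976, §1 p. 527] -/
theorem IsBimonotone₁.isSublattice (h : IsBimonotone₁ L) : IsSublattice L := by
  constructor
  · intro x hx y hy
    rcases le_total x.1 y.1 with h1 | h1 <;> rcases le_total x.2 y.2 with h2 | h2
    · rwa [Prod.sup_def, sup_eq_right.2 h1, sup_eq_right.2 h2]
    · rw [Prod.sup_def, sup_eq_right.2 h1, sup_eq_left.2 h2]; exact h hx h1 le_rfl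
    · rw [Prod.sup_def, sup_eq_left.2 h1, sup_eq_right.2 h2]; exact h hy h1 le_rfl
    · rwa [Prod.sup_def, sup_eq_left.2 h1, sup_eq_left.2 h2]
  · intro x hx y hy
    rcases le_total x.1 y.1 with h1 | h1 <;> rcases le_total x.2 y.2 with h2 | h2
    · rwa [Prod.inf_def, inf_eq_left.2 h1, inf_eq_left.2 h2]
    · rw [Prod.inf_def, inf_eq_left.2 h1, inf_eq_right.2 h2]; exact h hx le_rfl h2
    · rw [Prod.inf_def, inf_eq_right.2 h1, inf_eq_left.2 h2]; exact h hy le_rfl h2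
    · rwa [Prod.inf_def, inf_eq_right.2 h1, inf_eq_right.2 h2]

/-- "If `S₁` and `S₂` are chains then a bimonotone subset of `S₁ × S₂` is clearly a sublattice"
(second kind). [cite: Topkis1976, §1 p. 527] -/
theorem IsBimonotone₂.isSublattice (h : IsBimonotone₂ L) : IsSublattice L := by
  constructor
  · intro x hx y hy
    rcases le_total x.1 y.1 with h1 | h1 <;> rcases le_total x.2 y.2 with h2 | h2
    · rwa [Prod.sup_def, sup_eq_right.2 h1, sup_eq_right.2 h2]
    · rw [Prod.sup_def, sup_eq_right.2 h1, sup_eq_left.2 h2]; exact h hy le_rfl h2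
    · rw [Prod.sup_def, sup_eq_left.2 h1, sup_eq_right.2 h2]; exact h hx le_rfl h2
    · rwa [Prod.sup_def, sup_eq_left.2 h1, sup_eq_left.2 h2]
  · intro x hx y hy
    rcases le_total x.1 y.1 with h1 | h1 <;> rcases le_total x.2 y.2 with h2 | h2
    · rwa [Prod.inf_def, inf_eq_left.2 h1, inf_eq_left.2 h2]
    · rw [Prod.inf_def, inf_eq_left.2 h1, inf_eq_right.2 h2]; exact h hy h1 le_rfl
    · rw [Prod.inf_def, inf_eq_right.2 h1, inf_eq_left.2 h2]; exact h hx h1 le_rfl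
    · rwa [Prod.inf_def, inf_eq_right.2 h1, inf_eq_right.2 h2]

/-- "If `S₁` and `S₂` are chains then a bimonotone subset of `S₁ × S₂` is clearly a sublattice";
hence "the bimonotone hulls of any subset of such a product must be sublattices".
[cite: Topkis1976, §1 p. 527] -/
theorem IsBimonotone.isSublattice (h : IsBimonotone L) : IsSublattice L :=
  h.elim IsBimonotone₁.isSublattice IsBimonotone₂.isSublattice

end Chains

section Lattice

variable [Lattice S₁] [Lattice S₂] {L : Set (S₁ × S₂)}

/-- **Lemma 1** [Topkis1976]: "If `S₁` and `S₂` are lattices and `L` is a sublattice of `S₁ × S₂`,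
then the bimonotone hulls of `L` are sublattices" — first hull `H₁(L)`. [cite: Topkis1976, Lemma 1] -/
theorem isSublattice_bimonotoneHull₁ (hL : IsSublattice L) : IsSublattice (bimonotoneHull₁ L) := by
  constructor
  · rintro y ⟨x, hx, h1, h2⟩ y' ⟨x', hx', h1', h2'⟩
    refine ⟨x ⊔ x', hL.supClosed hx hx', ?_, ?_⟩
    · rw [Prod.fst_sup, Prod.fst_sup]; exact sup_le_sup h1 h1'
    · rw [Prod.snd_sup, Prod.snd_sup]; exact sup_le_sup h2 h2'
  · rintro y ⟨x, hx, h1, h2⟩ y' ⟨x', hx', h1', h2'⟩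
    refine ⟨x ⊓ x', hL.infClosed hx hx', ?_, ?_⟩
    · rw [Prod.fst_inf, Prod.fst_inf]; exact inf_le_inf h1 h1'
    · rw [Prod.snd_inf, Prod.snd_inf]; exact inf_le_inf h2 h2'

/-- **Lemma 1** [Topkis1976], second hull `H₂(L)` ("follows symmetrically"). [cite: Topkis1976, Lemma 1] -/
theorem isSublattice_bimonotoneHull₂ (hL : IsSublattice L) : IsSublattice (bimonotoneHull₂ L) := by
  constructor
  · rintro y ⟨x, hx, h1, h2⟩ y' ⟨x', hx', h1', h2'⟩
    refine ⟨x ⊔ x', hL.supClosed hx hx', ?_, ?_⟩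
    · rw [Prod.fst_sup, Prod.fst_sup]; exact sup_le_sup h1 h1'
    · rw [Prod.snd_sup, Prod.snd_sup]; exact sup_le_sup h2 h2'
  · rintro y ⟨x, hx, h1, h2⟩ y' ⟨x', hx', h1', h2'⟩
    refine ⟨x ⊓ x', hL.infClosed hx hx', ?_, ?_⟩
    · rw [Prod.fst_inf, Prod.fst_inf]; exact inf_le_inf h1 h1'
    · rw [Prod.snd_inf, Prod.snd_inf]; exact inf_le_inf h2 h2'

/-- **Lemma 2** [Topkis1976]: "If `S₁` and `S₂` are lattices, `L` is a sublattice of `S₁ × S₂`,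
`x₁ ∈ S₁`, `a₂ ∈ L₁(x₁)`, and `b₂ ∈ L₁(x₁)`, then `Π₂ L ∩ [a₂, b₂] ⊆ L₁(x₁)`" (section
`L₁(x₁) = {x₂ : (x₁, x₂) ∈ L}`, projection `Π₂ L`). [cite: Topkis1976, Lemma 2] -/
theorem IsSublattice.snd_image_inter_Icc_subset_section (hL : IsSublattice L) {x₁ : S₁}
    {a₂ b₂ : S₂} (ha : (x₁, a₂) ∈ L) (hb : (x₁, b₂) ∈ L) :
    Prod.snd '' L ∩ Icc a₂ b₂ ⊆ Prod.mk x₁ ⁻¹' L := by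
  rintro x₂ ⟨⟨⟨y₁, y₂⟩, hy, hyx⟩, hax, hxb⟩
  simp only at hyx
  subst hyx
  -- `(x₁ ⊔ y₁, y₂) = (x₁, a₂) ⊔ (y₁, y₂) ∈ L`, then `(x₁, y₂) = (x₁ ⊔ y₁, y₂) ⊓ (x₁, b₂) ∈ L`.
  have h1 : (x₁ ⊔ y₁, y₂) ∈ L := by
    have h := hL.supClosed ha hy
    rwa [Prod.mk_sup_mk, sup_eq_right.2 hax] at h
  have h2 := hL.infClosed h1 hb
  rwa [Prod.mk_inf_mk, inf_eq_right.2 le_sup_left, inf_eq_left.2 hxb] at h2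

/-- **Lemma 2** [Topkis1976], mirror form for sections at a point of `S₂`:
`a₁, b₁ ∈ L₂(x₂)` ⟹ `Π₁ L ∩ [a₁, b₁] ⊆ L₂(x₂)`. [cite: Topkis1976, Lemma 2] -/
theorem IsSublattice.fst_image_inter_Icc_subset_section (hL : IsSublattice L) {x₂ : S₂}
    {a₁ b₁ : S₁} (ha : (a₁, x₂) ∈ L) (hb : (b₁, x₂) ∈ L) :
    Prod.fst '' L ∩ Icc a₁ b₁ ⊆ (fun x₁ => (x₁, x₂)) ⁻¹' L := by
  rintro x₁ ⟨⟨⟨y₁, y₂⟩, hy, hyx⟩, hax, hxb⟩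
  simp only at hyx
  subst hyx
  have h1 : (y₁, x₂ ⊔ y₂) ∈ L := by
    have h := hL.supClosed ha hy
    rwa [Prod.mk_sup_mk, sup_eq_right.2 hax] at h
  have h2 := hL.infClosed h1 hb
  rwa [Prod.mk_inf_mk, inf_eq_left.2 hxb, inf_eq_right.2 le_sup_left] at h2

/-- **Corollary 1** [Topkis1976]: "If `S₁` and `S₂` are lattices, `L` is a sublattice of `S₁ × S₂`,
`x₁ ∈ S₁`, and `L₁(x₁)` contains its infimum `a₂` and its supremum `b₂`, then
`L₁(x₁) = Π₂ L ∩ [a₂, b₂]`." [cite: Topkis1976, Cor 1] -/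
theorem IsSublattice.section_eq_of_isLeast_isGreatest (hL : IsSublattice L) {x₁ : S₁} {a₂ b₂ : S₂}
    (ha : IsLeast (Prod.mk x₁ ⁻¹' L) a₂) (hb : IsGreatest (Prod.mk x₁ ⁻¹' L) b₂) :
    Prod.mk x₁ ⁻¹' L = Prod.snd '' L ∩ Icc a₂ b₂ := by
  refine Subset.antisymm (fun x₂ hx => ?_)
    (IsSublattice.snd_image_inter_Icc_subset_section hL ha.1 hb.1)
  exact ⟨⟨(x₁, x₂), hx, rfl⟩, ha.2 hx, hb.2 hx⟩

/-- **Theorem 2** [Topkis1976]: "If `S₁` and `S₂` are lattices and `L` is a sublattice of `S₁ × S₂`,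
then `L` is the intersection of its two bimonotone hulls and the product of its two projections."
[cite: Topkis1976, Thm 2] -/
theorem IsSublattice.eq_bimonotoneHull_inter_prod (hL : IsSublattice L) :
    L = bimonotoneHull₁ L ∩ bimonotoneHull₂ L ∩ (Prod.fst '' L) ×ˢ (Prod.snd '' L) := by
  refine Subset.antisymm (fun x hx => ⟨⟨subset_bimonotoneHull₁ L hx, subset_bimonotoneHull₂ L hx⟩,
    mem_image_of_mem _ hx, mem_image_of_mem _ hx⟩) ?_
  rintro ⟨x₁, x₂⟩ ⟨⟨⟨⟨y₁, y₂⟩, hy, hy1, hy2⟩, ⟨⟨w₁, w₂⟩, hw, hw1, hw2⟩⟩, hx1, hx2⟩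
  dsimp only at hy1 hy2 hw1 hw2 hx1 hx2
  -- `y₁ ≤ x₁ ≤ w₁`, `w₂ ≤ x₂ ≤ y₂`; `(y₁, w₂) = y ⊓ w ∈ L`.
  have hyw : (y₁, w₂) ∈ L := by
    have h := hL.infClosed hy hw
    rwa [Prod.mk_inf_mk, inf_eq_left.2 (hy1.trans hw1), inf_eq_right.2 (hw2.trans hy2)] at h
  -- Lemma 2 twice: `(y₁, x₂) ∈ L` and `(x₁, w₂) ∈ L`; their join is `x`.
  have hA : (y₁, x₂) ∈ L :=
    IsSublattice.snd_image_inter_Icc_subset_section hL hyw hy ⟨hx2, hw2, hy2⟩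
  have hB : (x₁, w₂) ∈ L :=
    IsSublattice.fst_image_inter_Icc_subset_section hL hyw hw ⟨hx1, hy1, hw1⟩
  have h := hL.supClosed hA hB
  rwa [Prod.mk_sup_mk, sup_eq_right.2 hy1, sup_eq_left.2 hw2] at h

end Lattice

end TwoFactors

/-! ### Corollary 2 and Theorem 3: bimonotone sublattices of `×ᵢ Sᵢ` -/

section Bimonotone

variable {j k : ι}

/-- p. 529: "If `S₁, …, Sₙ` are posets, `S = ×ᵢ Sᵢ`, `L` is a bivariate subset of `S`, `T` is the
`jk`-generator of `L`, and `T` is bimonotone, then `L` is *bimonotone*" (in the coordinates `j, k`).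
[cite: Topkis1976, §1 p. 529] -/
def IsBimonotoneIn [∀ i, Preorder (α i)] (j k : ι) (L : Set (∀ i, α i)) : Prop :=
  ∃ T : Set (α j × α k), IsBimonotone T ∧ L = cylinder j k T

/-- A cylinder over a bimonotone set is bimonotone. [cite: Topkis1976, §1 p. 529] -/
theorem IsBimonotone.isBimonotoneIn_cylinder [∀ i, Preorder (α i)] {T : Set (α j × α k)}
    (hT : IsBimonotone T) : IsBimonotoneIn j k (cylinder j k T) := ⟨T, hT, rfl⟩

/-- `Π₁ (π_{jk} L) = Π_j L`. [cite: Topkis1976, §1 p. 528] -/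
theorem fst_image_proj₂ (L : Set (∀ i, α i)) : Prod.fst '' proj₂ j k L = Function.eval j '' L := by
  ext a
  simp only [proj₂, Set.image_image, mem_image, Function.eval]

/-- `Π₂ (π_{jk} L) = Π_k L`. [cite: Topkis1976, §1 p. 528] -/
theorem snd_image_proj₂ (L : Set (∀ i, α i)) : Prod.snd '' proj₂ j k L = Function.eval k '' L := by
  ext a
  simp only [proj₂, Set.image_image, mem_image, Function.eval]

/-- `L ⊆ ×ᵢ Πᵢ L`. [cite: Topkis1976, Thm 3] -/
theorem subset_pi_eval_image (L : Set (∀ i, α i)) :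
    L ⊆ Set.pi univ fun i => Function.eval i '' L :=
  fun x hx => mem_univ_pi.2 fun _ => ⟨x, hx, rfl⟩

variable [∀ i, Lattice (α i)] {L : Set (∀ i, α i)}

/-- The projection `Πᵢ L` of a sublattice is a sublattice of `Sᵢ`. [cite: Topkis1976, §1 p. 528] -/
theorem isSublattice_eval_image (hL : IsSublattice L) (i : ι) :
    IsSublattice (Function.eval i '' L) :=
  hL.image (Pi.evalLatticeHom i)

/-- **Corollary 2** [Topkis1976]: "If `S₁, …, Sₙ` are lattices, `S = ×ᵢ Sᵢ`, and `L` is a bivariate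
sublattice of `S`, then `L` is the intersection of two bimonotone sublattices and `×ᵢ Πᵢ L`" — namely
the cylinders over the two bimonotone hulls of its generator `π_{jk} L` (bimonotone by
`isBimonotone₁_bimonotoneHull₁` / `isBimonotone₂_bimonotoneHull₂`, sublattices by Lemma 1 and
`isSublattice_cylinder`). [cite: Topkis1976, Cor 2] -/
theorem IsSublattice.eq_bimonotone_inter_pi_of_isBivariate (hL : IsSublattice L)
    (hB : IsBivariate j k L) :
    L = cylinder j k (bimonotoneHull₁ (proj₂ j k L)) ∩ cylinder j k (bimonotoneHull₂ (proj₂ j k L)) ∩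
      Set.pi univ fun i => Function.eval i '' L := by
  refine Subset.antisymm (fun x hx => ⟨⟨?_, ?_⟩, subset_pi_eval_image L hx⟩) ?_
  · exact subset_bimonotoneHull₁ _ (mk_mem_proj₂ hx)
  · exact subset_bimonotoneHull₂ _ (mk_mem_proj₂ hx)
  · rintro x ⟨⟨h1, h2⟩, h3⟩
    rw [mem_cylinder] at h1 h2
    rw [hB.eq_cylinder_proj₂, mem_cylinder,
      IsSublattice.eq_bimonotoneHull_inter_prod (isSublattice_proj₂ hL)]
    refine ⟨⟨h1, h2⟩, ?_, ?_⟩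
    · rw [fst_image_proj₂]; exact (mem_univ_pi.1 h3) j
    · rw [snd_image_proj₂]; exact (mem_univ_pi.1 h3) k

/-- **Theorem 3** [Topkis1976], the representation: a sublattice `L` of a finite product of `n > 1`
lattices is the intersection of the `n(n-1)` bimonotone sublattices `{x : (x_j, x_k) ∈ H₁(π_{jk} L)}`
(ordered pairs `j ≠ k`; the pair `(k, j)` contributes the cylinder over `H₂(π_{jk} L)`) and of
`×ᵢ Πᵢ L`. [cite: Topkis1976, Thm 3] -/
theorem IsSublattice.eq_iInter_bimonotone_inter_pi [Finite ι] [Nontrivial ι] (hL : IsSublattice L) :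
    L = (⋂ j, ⋂ k, ⋂ (_ : j ≠ k), cylinder j k (bimonotoneHull₁ (proj₂ j k L))) ∩
      Set.pi univ fun i => Function.eval i '' L := by
  refine Subset.antisymm (fun x hx => ⟨?_, subset_pi_eval_image L hx⟩) ?_
  · simp only [mem_iInter, mem_cylinder]
    exact fun j k _ => subset_bimonotoneHull₁ _ (mk_mem_proj₂ hx)
  · rintro x ⟨h12, h3⟩
    simp only [mem_iInter, mem_cylinder] at h12
    refine IsSublattice.mem_of_forall_ne_proj₂ hL fun j k hjk => ?_
    rw [IsSublattice.eq_bimonotoneHull_inter_prod (isSublattice_proj₂ hL)]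
    refine ⟨⟨h12 j k hjk, ?_⟩, ?_, ?_⟩
    · obtain ⟨y, hy, hy1, hy2⟩ := (mem_bimonotoneHull₁.1 (h12 k j hjk.symm))
      obtain ⟨z, hz, hz1, hz2⟩ := mem_proj₂.1 hy
      refine ⟨(z j, z k), mk_mem_proj₂ hz, ?_, ?_⟩
      · simp only at hy2 ⊢; rw [hz2]; exact hy2
      · simp only at hy1 ⊢; rw [hz1]; exact hy1
    · rw [fst_image_proj₂]; exact (mem_univ_pi.1 h3) j
    · rw [snd_image_proj₂]; exact (mem_univ_pi.1 h3) k

/-- **Theorem 3** [Topkis1976] (iff form, general lattices): "a set `L` is a sublattice of `S` if and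
only if it is the intersection of `n(n-1)` bimonotone sublattices of `S` and `×ᵢ Πᵢ L`" — with the
requirement that the projections `Πᵢ L` be sublattices (tacit in the printed converse) made explicit.
[cite: Topkis1976, Thm 3] -/
theorem isSublattice_iff_exists_bimonotone [Finite ι] [Nontrivial ι] {L : Set (∀ i, α i)} :
    IsSublattice L ↔ (∀ i, IsSublattice (Function.eval i '' L)) ∧
      ∃ B : ∀ j k : ι, Set (α j × α k), (∀ j k, j ≠ k → IsBimonotone (B j k) ∧ IsSublattice (B j k)) ∧
        L = (⋂ j, ⋂ k, ⋂ (_ : j ≠ k), cylinder j k (B j k)) ∩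
          Set.pi univ fun i => Function.eval i '' L := by
  constructor
  · intro hL
    refine ⟨isSublattice_eval_image hL, fun j k => bimonotoneHull₁ (proj₂ j k L),
      fun j k _ => ⟨?_, ?_⟩, IsSublattice.eq_iInter_bimonotone_inter_pi hL⟩
    · exact Or.inl (isBimonotone₁_bimonotoneHull₁ _)
    · exact isSublattice_bimonotoneHull₁ (isSublattice_proj₂ hL)
  · rintro ⟨hπ, B, hB, hLB⟩
    rw [hLB]
    exact (isSublattice_iInter fun j => isSublattice_iInter fun k => isSublattice_iInter fun hjk =>
      isSublattice_cylinder (hB j k hjk).2).inter (isSublattice_pi fun i _ => hπ i)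

/-- **Theorem 3** [Topkis1976] (iff form) for products of chains, where every bimonotone set and every
product `×ᵢ Πᵢ L` is automatically a sublattice: `L` is a sublattice iff it is the intersection of
`n(n-1)` bimonotone sets (cylinders over bimonotone generators) and `×ᵢ Πᵢ L`. [cite: Topkis1976, Thm 3] -/
theorem isSublattice_iff_exists_bimonotone_of_linearOrder {β : ι → Type v} [∀ i, LinearOrder (β i)]
    [Finite ι] [Nontrivial ι] {L : Set (∀ i, β i)} :
    IsSublattice L ↔ ∃ B : ∀ j k : ι, Set (β j × β k), (∀ j k, j ≠ k → IsBimonotone (B j k)) ∧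
      L = (⋂ j, ⋂ k, ⋂ (_ : j ≠ k), cylinder j k (B j k)) ∩
        Set.pi univ fun i => Function.eval i '' L := by
  rw [isSublattice_iff_exists_bimonotone]
  constructor
  · rintro ⟨-, B, hB, hLB⟩
    exact ⟨B, fun j k hjk => (hB j k hjk).1, hLB⟩
  · rintro ⟨B, hB, hLB⟩
    exact ⟨fun i => LinearOrder.isSublattice _, B,
      fun j k hjk => ⟨hB j k hjk, (hB j k hjk).isSublattice⟩, hLB⟩

end Bimonotone

end Literature.Order.Sublattices
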